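import Mathlib
import HarnessLib
import Summits.Ventures.LatticeQCDFlow.Exactness.NCMCGeneralSpaceSampleSizeDilution
import Summits.Ventures.LatticeQCDFlow.Exactness.NCMCGeneralSpaceDoeblinGeometric

/-!
# NCMCGeneralSpaceLaunchIntervalDilution — the sample size along the restart chain launched every
# `m + 1` sweeps, with BOTH levers typed: `N_eff = N/(1 + 2α·q^{m+1}/(1 − q^{m+1}))`, `q = 1 − ε`

HONEST FRAMING: exact (Metropolis-corrected) sampling algorithms for lattice gauge theory;
figures of merit are autocorrelation/cost numbers at stated couplings and volumes; no
continuum-physics claim.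

Venture `LatticeQCDFlow` (cell pub-lqcd); FANOUT row 19 (`su2-snf`, GEN-9: levers `protocol.n_between`
and the protocol's dilution).  OUR WORK; nothing is cited as a fact.  The docking of the three GEN-9
pieces: the dilution constant `α` of the work class (`Exactness/NCMCGeneralSpaceSampleSizeDilution`),
the geometric improvement `ε_m = 1 − (1 − ε)^{m+1}` of a one-sweep Doeblin constant by the invariant
law (`Exactness/NCMCGeneralSpaceDoeblinGeometric`), and the envelope `C(m) = 1 + 2α·q^m/(1 − q^m)`
optimised in `Scaling/LaunchIntervalLaw`.

* **`CrooksPair.jarzynski_sampleSize_sufficient_restartChain_nHit_dilution`** — Crooks pair with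
  `Z₀, Z₁ ≠ 0`, `e^{−ΔF} = Z₁/Z₀`; a `ν₀`-invariant one-sweep kernel `κ₁` with `ε·(Z₀⁻¹ν₀)(B) ≤ κ₁(z, B)`
  (`ε > 0`); launches every `m + 1` sweeps (`K = nHit κ₁ (m+1)`); a dilution constant `α ≥ 0` of the
  bounded functions of the work; `N ≥ exp(E_{P_R}[ΔF − W] + t)` consecutive evolutions.  Then
  `E|Ẑ_N e^{ΔF} − 1| ≤ √(1 + 2α(1/ε_m − 1))·e^{−t/4} + 2√(P_R-tail)` with `ε_m = 1 − (1 − ε)^{m+1}`;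
* `CrooksPair.launchInflation_eq` — the factor is `Scaling/LaunchIntervalLaw`'s envelope:
  `1 + 2α(1/ε_m − 1) = 1 + 2α·q^{m+1}/(1 − q^{m+1})`, `q = 1 − ε` (in `ℝ`, `ε ≤ 1`).

Reading (value-free): the two levers of the restart chain enter the certified sample size only
through the ONE number `α·q^{n_between}/(1 − q^{n_between})`; row 19's F1/F2 weights show
`α·ρ_h(n_between) ≈ 0` at the card's `n_between` (HOME/su2-snf/xcheck/launch-gen9), i.e. the factor is
`≈ 1` there.  NOT CLAIMED: `ε`, `α` for any concrete sampler/protocol.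
-/

namespace Summit.Ventures.LatticeQCDFlow.Exactness.GeneralNCMC

open MeasureTheory ProbabilityTheory Set Filter Finset
open scoped ENNReal

variable {Ω E : Type*} [MeasurableSpace Ω] [MeasurableSpace E]

namespace CrooksPair

variable {ν₀ ν₁ : Measure Ω} {κF κR : Kernel Ω E} {s e : E → Ω} {W : E → ℝ}

/-- **THE RESTART CHAIN LAUNCHED EVERY `m + 1` SWEEPS, WITH DILUTION.**  See the module docstring. -/
theorem jarzynski_sampleSize_sufficient_restartChain_nHit_dilution (κ₁ : Kernel Ω Ω)
    [IsMarkovKernel κ₁] [IsFiniteMeasure ν₀] [IsFiniteMeasure ν₁] [IsMarkovKernel κF]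
    [IsMarkovKernel κR] (h0 : ν₀ univ ≠ 0) (h1 : ν₁ univ ≠ 0) (hK : Kernel.Invariant κ₁ ν₀)
    (h : CrooksPair ν₀ ν₁ κF κR s e W) {ΔF : ℝ}
    (hΔF : Real.exp (-ΔF) = ((ν₀ univ)⁻¹ * ν₁ univ).toReal)
    {ε : ℝ≥0∞} (hε0 : 0 < ε)
    (hmin : ∀ z (B : Set Ω), MeasurableSet B → ε * ((ν₀ univ)⁻¹ • ν₀) B ≤ κ₁ z B) (m : ℕ)
    {α : ℝ} (hα0 : 0 ≤ α)
    (hα : ∀ φ : ℝ → ℝ, Measurable φ → ∀ B' : ℝ, (∀ u, |φ u| ≤ B') →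
      Var[fun z => ∫ ω, φ (W ω) ∂(κF z); (ν₀ univ)⁻¹ • ν₀] ≤ α * Var[fun ω => φ (W ω); fwdPathLaw ν₀ κF])
    {N : ℕ} {t : ℝ} (hN : Real.exp ((∫ ε', (ΔF - W ε') ∂(fwdPathLaw ν₁ κR)) + t) ≤ N) :
    haveI := isProbabilityMeasure_fwdPathLaw ν₀ h0 κF
    haveI := isMarkovKernel_nHit κ₁ (m + 1)
    ∫ x, |(1 / (N : ℝ)) * ∑ i ∈ range N, Real.exp (ΔF - W (x i)) - 1|
        ∂(Kernel.trajMeasure (X := fun _ : ℕ => E) (fwdPathLaw ν₀ κF)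
          (fun n : ℕ => ((κF ∘ₖ nHit κ₁ (m + 1)).comap s h.measurable_s).comap
            (fun hh : (j : ↥(Finset.Iic n)) → E => hh ⟨n, Finset.mem_Iic.2 le_rfl⟩)
            (measurable_pi_apply _)))
      ≤ Real.sqrt (1 + 2 * α * (1 / (1 - (1 - ε) ^ (m + 1)).toReal - 1)) * Real.exp (-t / 4)
        + 2 * Real.sqrt ((fwdPathLaw ν₁ κR)
            {ε' | (∫ ε'', (ΔF - W ε'') ∂(fwdPathLaw ν₁ κR)) + t / 2 < ΔF - W ε'}).toReal := by
  haveI := isMarkovKernel_nHit κ₁ (m + 1)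
  haveI : IsProbabilityMeasure ((ν₀ univ)⁻¹ • ν₀) := by
    constructor
    rw [Measure.smul_apply, smul_eq_mul, ENNReal.inv_mul_cancel h0 (measure_ne_top _ _)]
  have hπ₀ : Kernel.Invariant κ₁ ((ν₀ univ)⁻¹ • ν₀) := invariant_smul κ₁ hK _
  have hminK : ∀ z (B : Set Ω), MeasurableSet B →
      (1 - (1 - ε) ^ (m + 1)) * ((ν₀ univ)⁻¹ • ν₀) B ≤ nHit κ₁ (m + 1) z B :=
    fun z B hB => doeblin_nHit_geometric (κ := κ₁) (π := (ν₀ univ)⁻¹ • ν₀) hπ₀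
      (fun x B hB => hmin x B hB) m z hB
  have hεm : 0 < 1 - (1 - ε) ^ (m + 1) := by
    have hlt : (1 - ε) ^ (m + 1) < 1 := by
      have h1' : 1 - ε < 1 := ENNReal.sub_lt_self ENNReal.one_ne_top one_ne_zero hε0.ne'
      exact pow_lt_one₀ bot_le h1' (Nat.succ_ne_zero m)
    exact tsub_pos_of_lt hlt
  exact h.jarzynski_sampleSize_sufficient_restartChain_dilution (nHit κ₁ (m + 1)) h0 h1
    (invariant_nHit hK _) hΔF hεm hminK hα0 hα hN

/-- **The factor is the launch-interval envelope**: for `ε ≤ 1` in `ℝ` with `(1 − ε)^{m+1} ≠ 1`,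
`1 + 2α(1/(1 − (1−ε)^{m+1}) − 1) = 1 + 2α·(1−ε)^{m+1}/(1 − (1−ε)^{m+1})` — `Scaling/LaunchIntervalLaw`'s
`C(m+1)` with `q = 1 − ε`. -/
theorem launchInflation_eq {ε α : ℝ} {m : ℕ} (h : (1 - ε) ^ (m + 1) ≠ 1) :
    1 + 2 * α * (1 / (1 - (1 - ε) ^ (m + 1)) - 1)
      = 1 + 2 * α * (1 - ε) ^ (m + 1) / (1 - (1 - ε) ^ (m + 1)) := by
  rw [one_div_geometricDoeblin_sub_one h]
  ring

end CrooksPair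

end Summit.Ventures.LatticeQCDFlow.Exactness.GeneralNCMC
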